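import Literature.RingTheory.MvPolynomial.GeomComponentsInvariantLabel
import HarnessLib

/-!
# Galois descent from a point with few branches

Companion of `Literature.RingTheory.MvPolynomial.GeomComponentsGaloisAction` and
`Literature.RingTheory.MvPolynomial.GeomComponentsInvariantLabel` (Stacks Project, Tag 04KZ: the
geometric irreducible components of a `k`-component of an affine `k`-variety form ONE
`Gal(K/k)`-orbit). There, a geometric component `W = V(Q)` through an `E`-rational point `y`
(`E/k` finite) is shown to have at most `[E:k]` conjugates when it is the UNIQUE component through
`y` (optionally: the unique one carrying a Galois-invariant label). The same orbit–stabiliser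
count gives the general bound, with no uniqueness assumption at all:

  `#(Gal-orbit of W) ≤ [E : k] · #{components through y (carrying the label)}`,

because an element of `Gal(K/k)` agreeing with a fixed lift of its restriction to `E` differs from
that lift by an element FIXING `y`, which carries `W` to another (labelled) component through `y`.

* `map_algEquiv_mem_branches` — an element of `Gal(K/k)` fixing `y` permutes the labelled
  components through `y`;
* `ncard_minimalPrimes_map_le_finrank_mul_ncard_of_invariant` — the labelled orbit bound
  `#IrredComp(V(𝔭)_K) ≤ [E:k] · #(labelled branches at y)` for `𝔭 = Q ∩ k[X_σ]`;
* `exists_mem_minimalPrimes_ncard_map_le_finrank_mul_of_invariant` — **labelled few-branches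
  descent**: if some labelled component passes through `y`, some minimal prime `𝔭 ⊇ I` has
  `0 < #IrredComp(V(𝔭)_K) ≤ [E:k] · #(labelled branches at y)`;
* `ncard_minimalPrimes_map_le_finrank_mul_ncard`,
  `exists_mem_minimalPrimes_ncard_map_le_finrank_mul`,
  `exists_mem_minimalPrimes_ncard_map_le_finrank_mul_of_map_le_ker` — the unlabelled forms (all
  components through `y`; the last one only assumes `y ∈ V(I)`).

The uniqueness statements of the companion files are the case of exactly one (labelled) branch.

Motivation (route `ValiantsHypothesis/LangWeilTransfer`, crux `ShatteringExclusion`, line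
`birth` v2): a low-degree point of the constants variety of a circuit lying on polynomially many
geometric components certifies a component with polynomially many Galois conjugates — the weakest
point certificate the line can use. Not here: base change `k̄ ↔ ℂ` (see
`GeomComponentCountBaseChange`).

## References
* The Stacks Project, Tag 04KZ (and 038J, 04KY). [StacksProject]
-/

noncomputable section

open MvPolynomial
open scoped Pointwise

namespace Literature.RingTheory.MvPolynomial

variable {k : Type*} [Field k] {K : Type*} [Field K] [Algebra k K] {σ : Type*}

/-- `map (g * h) = map g ∘ map h` for the coefficientwise action. [folklore] -/
private theorem map_algEquiv_mul₃ (g h : K ≃ₐ[k] K) :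
    MvPolynomial.map (σ := σ) ((g * h : K ≃ₐ[k] K) : K →+* K) =
      (MvPolynomial.map (g : K →+* K)).comp (MvPolynomial.map (h : K →+* K)) := by
  refine RingHom.ext fun p => ?_
  rw [RingHom.comp_apply, MvPolynomial.map_map]
  rfl

/-- `ev_y (pᵍ) = g (ev_y p)` when `g` fixes the point `y`. [folklore] -/
private theorem aeval_map_algEquiv_of_forall_apply_eq₃ (g : K ≃ₐ[k] K) (y : σ → K)
    (hy : ∀ v, g (y v) = y v) (p : MvPolynomial σ K) :
    MvPolynomial.aeval y (MvPolynomial.map (g : K →+* K) p) = g (MvPolynomial.aeval y p) := by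
  rw [MvPolynomial.aeval_def, MvPolynomial.eval₂_map, MvPolynomial.aeval_def,
    show (g (MvPolynomial.eval₂ (algebraMap K K) y p)) =
      (g : K →+* K) (MvPolynomial.eval₂ (algebraMap K K) y p) from rfl,
    MvPolynomial.eval₂_comp_left]
  congr 1
  ext v
  exact (hy v).symm

/-! ### The labelled branches at a point are permuted by the stabiliser of the point -/

/-- **An element of `Gal(K/k)` fixing the point `y` permutes the labelled branches at `y`.** If
`g (y v) = y v` for all `v`, `lab` is a `Gal(K/k)`-invariant property of ideals, and `Q` is a
minimal prime over `I K[X_σ]` lying in `𝔪_y = ker (ev_y)` with `lab Q`, then so is `Qᵍ`.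
[cite: StacksProject, Tag 04KZ] -/
theorem map_algEquiv_mem_branches (lab : Ideal (MvPolynomial σ K) → Prop)
    (hlab : ∀ (g : K ≃ₐ[k] K) (Q' : Ideal (MvPolynomial σ K)),
      lab Q' → lab (Q'.map (MvPolynomial.map (g : K →+* K))))
    (g : K ≃ₐ[k] K) (I : Ideal (MvPolynomial σ k)) (y : σ → K) (hy : ∀ v, g (y v) = y v)
    {Q : Ideal (MvPolynomial σ K)}
    (hQ : Q ∈ (I.map (MvPolynomial.map (algebraMap k K))).minimalPrimes)
    (hQy : Q ≤ RingHom.ker (MvPolynomial.aeval (R := K) y)) (hlabQ : lab Q) :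
    Q.map (MvPolynomial.map (g : K →+* K)) ∈
        {Q' : Ideal (MvPolynomial σ K) |
          Q' ∈ (I.map (MvPolynomial.map (algebraMap k K))).minimalPrimes ∧
            Q' ≤ RingHom.ker (MvPolynomial.aeval (R := K) y) ∧ lab Q'} := by
  refine ⟨map_algEquiv_mem_minimalPrimes_map g I hQ, ?_, hlab g Q hlabQ⟩
  rw [Ideal.map_le_iff_le_comap]
  intro p hp
  have h1 : MvPolynomial.aeval y p = 0 := (RingHom.mem_ker).1 (hQy hp)
  rw [Ideal.mem_comap, RingHom.mem_ker, aeval_map_algEquiv_of_forall_apply_eq₃ g y hy, h1, map_zero]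

/-- The labelled branches at a point form a finite set (`σ` finite: there are finitely many
minimal primes over `I K[X_σ]`). [folklore] -/
private theorem finite_branches [Finite σ] (lab : Ideal (MvPolynomial σ K) → Prop)
    (I : Ideal (MvPolynomial σ k)) (y : σ → K) :
    {Q' : Ideal (MvPolynomial σ K) |
        Q' ∈ (I.map (MvPolynomial.map (algebraMap k K))).minimalPrimes ∧
          Q' ≤ RingHom.ker (MvPolynomial.aeval (R := K) y) ∧ lab Q'}.Finite :=
  (Ideal.finite_minimalPrimes_of_isNoetherianRing (MvPolynomial σ K) _).subset fun _ h => h.1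

/-! ### The orbit bound -/

/-- **Labelled orbit bound (few branches).** Let `K ⊇ k` be algebraically closed and Galois over
`k`, `E` an intermediate field finite over `k`, `y ∈ E^σ`, `I ⊆ k[X_σ]`, `lab` a
`Gal(K/k)`-invariant property of ideals of `K[X_σ]`, and `Q` a minimal prime over `I K[X_σ]`
in `𝔪_y` with `lab Q`. Then for `𝔭 = Q ∩ k[X_σ]` the number of minimal primes over `𝔭 K[X_σ]`
(the Galois conjugates of `Q`, Tag 04KY) is at most `[E : k]` times the number of minimal primes
over `I K[X_σ]` in `𝔪_y` carrying `lab`: writing `g = g_ψ · h` with `g_ψ` a fixed lift of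
`ψ = g|_E` and `h` fixing `y`, one has `Qᵍ = (Qʰ)^{g_ψ}` with `Qʰ` a labelled branch at `y`.
[cite: StacksProject, Tag 04KZ] -/
theorem ncard_minimalPrimes_map_le_finrank_mul_ncard_of_invariant [IsGalois k K] [IsAlgClosed K]
    [Finite σ] (lab : Ideal (MvPolynomial σ K) → Prop)
    (hlab : ∀ (g : K ≃ₐ[k] K) (Q' : Ideal (MvPolynomial σ K)),
      lab Q' → lab (Q'.map (MvPolynomial.map (g : K →+* K))))
    (I : Ideal (MvPolynomial σ k)) (y : σ → K) (E : IntermediateField k K)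
    [FiniteDimensional k E] (hyE : ∀ v, y v ∈ E) {Q : Ideal (MvPolynomial σ K)}
    (hQ : Q ∈ (I.map (MvPolynomial.map (algebraMap k K))).minimalPrimes)
    (hQy : Q ≤ RingHom.ker (MvPolynomial.aeval (R := K) y)) (hlabQ : lab Q) :
    (((Q.comap (MvPolynomial.map (algebraMap k K))).map
        (MvPolynomial.map (algebraMap k K))).minimalPrimes).ncard ≤
      Module.finrank k E *
        {Q' : Ideal (MvPolynomial σ K) |
          Q' ∈ (I.map (MvPolynomial.map (algebraMap k K))).minimalPrimes ∧
            Q' ≤ RingHom.ker (MvPolynomial.aeval (R := K) y) ∧ lab Q'}.ncard := by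
  classical
  haveI : Q.IsPrime := hQ.1.1
  set S : Set (Ideal (MvPolynomial σ K)) :=
    {Q' : Ideal (MvPolynomial σ K) |
      Q' ∈ (I.map (MvPolynomial.map (algebraMap k K))).minimalPrimes ∧
        Q' ≤ RingHom.ker (MvPolynomial.aeval (R := K) y) ∧ lab Q'} with hS
  have hSfin : S.Finite := finite_branches lab I y
  set 𝔭 : Ideal (MvPolynomial σ k) := Q.comap (MvPolynomial.map (algebraMap k K)) with h𝔭
  haveI : 𝔭.IsPrime := Ideal.comap_isPrime _ Q
  have hQ𝔭 : Q ∈ (𝔭.map (MvPolynomial.map (algebraMap k K))).minimalPrimes :=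
    mem_minimalPrimes_map_comap_of_mem_minimalPrimes_map I hQ
  -- the restriction map and a chosen lift of each restriction in its image
  let res : (K ≃ₐ[k] K) → (E →ₐ[k] K) := fun g => (g : K →ₐ[k] K).comp E.val
  let F : (E →ₐ[k] K) × Ideal (MvPolynomial σ K) → Ideal (MvPolynomial σ K) := fun p =>
    if hψ : ∃ g, res g = p.1 then p.2.map (MvPolynomial.map (hψ.choose : K →+* K)) else ⊥
  -- every conjugate of `Q` is `F (ψ, Q')` for a labelled branch `Q'` at `y`
  have hsub : (𝔭.map (MvPolynomial.map (algebraMap k K))).minimalPrimes ⊆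
      F '' ((Set.univ : Set (E →ₐ[k] K)) ×ˢ S) := by
    intro Q' hQ'
    obtain ⟨g, hg⟩ := exists_map_algEquiv_eq_of_mem_minimalPrimes_map 𝔭 hQ𝔭 hQ'
    have hψ : ∃ g', res g' = res g := ⟨g, rfl⟩
    set g₁ : K ≃ₐ[k] K := hψ.choose with hg₁
    have hres : res g₁ = res g := hψ.choose_spec
    -- `h = g₁⁻¹ g` fixes `y`
    have hfix : ∀ v, (g₁⁻¹ * g) (y v) = y v := fun v => by
      have h1 : g₁ (y v) = g (y v) := by
        have := congr_arg (fun f : E →ₐ[k] K => f ⟨y v, hyE v⟩) hres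
        exact this
      rw [AlgEquiv.mul_apply, ← h1]
      exact g₁.symm_apply_apply (y v)
    have hbr := map_algEquiv_mem_branches lab hlab (g₁⁻¹ * g) I y hfix hQ hQy hlabQ
    refine ⟨(res g, Q.map (MvPolynomial.map ((g₁⁻¹ * g : K ≃ₐ[k] K) : K →+* K))),
      ⟨Set.mem_univ _, hbr⟩, ?_⟩
    have hg' : g = g₁ * (g₁⁻¹ * g) := by group
    change (if hψ' : ∃ g', res g' = res g then _ else ⊥) = Q'
    rw [dif_pos hψ, Ideal.map_map, ← hg₁, ← map_algEquiv_mul₃, ← hg', hg]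
  -- count
  haveI : Algebra.IsSeparable k E := IntermediateField.isSeparable_tower_bot k E
  have hfin : ((Set.univ : Set (E →ₐ[k] K)) ×ˢ S).Finite := Set.finite_univ.prod hSfin
  calc ((𝔭.map (MvPolynomial.map (algebraMap k K))).minimalPrimes).ncard
      ≤ (F '' ((Set.univ : Set (E →ₐ[k] K)) ×ˢ S)).ncard :=
        Set.ncard_le_ncard hsub (hfin.image F)
    _ ≤ ((Set.univ : Set (E →ₐ[k] K)) ×ˢ S).ncard := Set.ncard_image_le hfin
    _ = (Set.univ : Set (E →ₐ[k] K)).ncard * S.ncard := Set.ncard_prod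
    _ = Module.finrank k E * S.ncard := by
        rw [Set.ncard_univ, Nat.card_eq_fintype_card, AlgHom.card k E K]

/-- **Labelled few-branches descent**: for `I ⊆ k[X_σ]` (`σ` finite), `E/k` finite inside the
algebraically closed Galois extension `K`, a point `y ∈ E^σ`, a `Gal(K/k)`-invariant label `lab`,
and a minimal prime `Q` over `I K[X_σ]` in `𝔪_y` with `lab Q`: some minimal prime `𝔭 ⊇ I`
(namely `Q ∩ k[X_σ]`) has `0 < #IrredComp(V(𝔭)_K) ≤ [E : k] · #(labelled branches at y)`.
[cite: StacksProject, Tag 04KZ] -/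
theorem exists_mem_minimalPrimes_ncard_map_le_finrank_mul_of_invariant [IsGalois k K]
    [IsAlgClosed K] [Finite σ] (lab : Ideal (MvPolynomial σ K) → Prop)
    (hlab : ∀ (g : K ≃ₐ[k] K) (Q' : Ideal (MvPolynomial σ K)),
      lab Q' → lab (Q'.map (MvPolynomial.map (g : K →+* K))))
    (I : Ideal (MvPolynomial σ k)) (y : σ → K) (E : IntermediateField k K)
    [FiniteDimensional k E] (hyE : ∀ v, y v ∈ E) {Q : Ideal (MvPolynomial σ K)}
    (hQ : Q ∈ (I.map (MvPolynomial.map (algebraMap k K))).minimalPrimes)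
    (hQy : Q ≤ RingHom.ker (MvPolynomial.aeval (R := K) y)) (hlabQ : lab Q) :
    ∃ 𝔭 ∈ I.minimalPrimes,
      0 < ((𝔭.map (MvPolynomial.map (algebraMap k K))).minimalPrimes).ncard ∧
        ((𝔭.map (MvPolynomial.map (algebraMap k K))).minimalPrimes).ncard ≤
          Module.finrank k E *
            {Q' : Ideal (MvPolynomial σ K) |
              Q' ∈ (I.map (MvPolynomial.map (algebraMap k K))).minimalPrimes ∧
                Q' ≤ RingHom.ker (MvPolynomial.aeval (R := K) y) ∧ lab Q'}.ncard := by
  refine ⟨Q.comap (MvPolynomial.map (algebraMap k K)),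
    comap_mem_minimalPrimes_of_mem_minimalPrimes_map I hQ, ?_,
    ncard_minimalPrimes_map_le_finrank_mul_ncard_of_invariant lab hlab I y E hyE hQ hQy hlabQ⟩
  have hmem := mem_minimalPrimes_map_comap_of_mem_minimalPrimes_map I hQ
  have hfin : ((Q.comap (MvPolynomial.map (algebraMap k K))).map
      (MvPolynomial.map (algebraMap k K))).minimalPrimes.Finite :=
    Ideal.finite_minimalPrimes_of_isNoetherianRing (MvPolynomial σ K) _
  exact (Set.ncard_pos hfin).2 ⟨Q, hmem⟩

/-! ### Unlabelled forms: all branches at the point -/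

/-- The branches at `y` are the `True`-labelled branches. [folklore] -/
private theorem branches_eq_branches_true (I : Ideal (MvPolynomial σ k)) (y : σ → K) :
    {Q' : Ideal (MvPolynomial σ K) |
        Q' ∈ (I.map (MvPolynomial.map (algebraMap k K))).minimalPrimes ∧
          Q' ≤ RingHom.ker (MvPolynomial.aeval (R := K) y)} =
      {Q' : Ideal (MvPolynomial σ K) |
        Q' ∈ (I.map (MvPolynomial.map (algebraMap k K))).minimalPrimes ∧
          Q' ≤ RingHom.ker (MvPolynomial.aeval (R := K) y) ∧ True} := by
  ext Q'
  simp only [Set.mem_setOf_eq, and_true]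

/-- **Orbit bound (few branches)**: with `K, E, y, I, Q` as above (no label), the number of
conjugates of the component `V(Q)` through `y` is at most `[E : k]` times the number of
irreducible components of `V(I)_K` through `y`. [cite: StacksProject, Tag 04KZ] -/
theorem ncard_minimalPrimes_map_le_finrank_mul_ncard [IsGalois k K] [IsAlgClosed K] [Finite σ]
    (I : Ideal (MvPolynomial σ k)) (y : σ → K) (E : IntermediateField k K)
    [FiniteDimensional k E] (hyE : ∀ v, y v ∈ E) {Q : Ideal (MvPolynomial σ K)}
    (hQ : Q ∈ (I.map (MvPolynomial.map (algebraMap k K))).minimalPrimes)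
    (hQy : Q ≤ RingHom.ker (MvPolynomial.aeval (R := K) y)) :
    (((Q.comap (MvPolynomial.map (algebraMap k K))).map
        (MvPolynomial.map (algebraMap k K))).minimalPrimes).ncard ≤
      Module.finrank k E *
        {Q' : Ideal (MvPolynomial σ K) |
          Q' ∈ (I.map (MvPolynomial.map (algebraMap k K))).minimalPrimes ∧
            Q' ≤ RingHom.ker (MvPolynomial.aeval (R := K) y)}.ncard := by
  rw [branches_eq_branches_true]
  exact ncard_minimalPrimes_map_le_finrank_mul_ncard_of_invariant (fun _ => True)
    (fun _ _ _ => trivial) I y E hyE hQ hQy trivial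

/-- **Few-branches descent**: for `I ⊆ k[X_σ]` (`σ` finite), `E/k` finite inside the
algebraically closed Galois extension `K`, a point `y ∈ E^σ` and a minimal prime `Q` over
`I K[X_σ]` in `𝔪_y`: some minimal prime `𝔭 ⊇ I` has
`0 < #IrredComp(V(𝔭)_K) ≤ [E : k] · #(branches of V(I)_K at y)`. [cite: StacksProject, Tag 04KZ] -/
theorem exists_mem_minimalPrimes_ncard_map_le_finrank_mul [IsGalois k K] [IsAlgClosed K]
    [Finite σ] (I : Ideal (MvPolynomial σ k)) (y : σ → K) (E : IntermediateField k K)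
    [FiniteDimensional k E] (hyE : ∀ v, y v ∈ E) {Q : Ideal (MvPolynomial σ K)}
    (hQ : Q ∈ (I.map (MvPolynomial.map (algebraMap k K))).minimalPrimes)
    (hQy : Q ≤ RingHom.ker (MvPolynomial.aeval (R := K) y)) :
    ∃ 𝔭 ∈ I.minimalPrimes,
      0 < ((𝔭.map (MvPolynomial.map (algebraMap k K))).minimalPrimes).ncard ∧
        ((𝔭.map (MvPolynomial.map (algebraMap k K))).minimalPrimes).ncard ≤
          Module.finrank k E *
            {Q' : Ideal (MvPolynomial σ K) |
              Q' ∈ (I.map (MvPolynomial.map (algebraMap k K))).minimalPrimes ∧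
                Q' ≤ RingHom.ker (MvPolynomial.aeval (R := K) y)}.ncard := by
  rw [branches_eq_branches_true]
  exact exists_mem_minimalPrimes_ncard_map_le_finrank_mul_of_invariant (fun _ => True)
    (fun _ _ _ => trivial) I y E hyE hQ hQy trivial

/-- **Few-branches descent from a point of the variety**: if `y ∈ E^σ` is a zero of `I`
(`I K[X_σ] ≤ 𝔪_y`), some minimal prime `𝔭 ⊇ I` has
`0 < #IrredComp(V(𝔭)_K) ≤ [E : k] · #(branches of V(I)_K at y)` — the component may be taken
through `y`. The case of a single branch is `exists_mem_minimalPrimes_ncard_map_le_finrank`.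
[cite: StacksProject, Tag 04KZ] -/
theorem exists_mem_minimalPrimes_ncard_map_le_finrank_mul_of_map_le_ker [IsGalois k K]
    [IsAlgClosed K] [Finite σ] (I : Ideal (MvPolynomial σ k)) (y : σ → K)
    (E : IntermediateField k K) [FiniteDimensional k E] (hyE : ∀ v, y v ∈ E)
    (hIy : I.map (MvPolynomial.map (algebraMap k K)) ≤
      RingHom.ker (MvPolynomial.aeval (R := K) y)) :
    ∃ 𝔭 ∈ I.minimalPrimes,
      0 < ((𝔭.map (MvPolynomial.map (algebraMap k K))).minimalPrimes).ncard ∧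
        ((𝔭.map (MvPolynomial.map (algebraMap k K))).minimalPrimes).ncard ≤
          Module.finrank k E *
            {Q' : Ideal (MvPolynomial σ K) |
              Q' ∈ (I.map (MvPolynomial.map (algebraMap k K))).minimalPrimes ∧
                Q' ≤ RingHom.ker (MvPolynomial.aeval (R := K) y)}.ncard := by
  haveI : (RingHom.ker (MvPolynomial.aeval (R := K) y)).IsPrime := RingHom.ker_isPrime _
  obtain ⟨Q, hQ, hQy⟩ := Ideal.exists_minimalPrimes_le hIy
  exact exists_mem_minimalPrimes_ncard_map_le_finrank_mul I y E hyE hQ hQy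

/-! ### The branches at a rational point do not depend on the algebraically closed field -/

section BaseChange

variable {L : Type*} [Field L] [Algebra K L]

/-- For `Q ⊆ K[X_σ]` and a point `y ∈ K^σ`: `Q L[X_σ]` vanishes at `y` iff `Q` does
(`Q L[X_σ] ≤ ker (ev_y)` in `L[X_σ]` iff `Q ≤ ker (ev_y)` in `K[X_σ]`). [folklore] -/
private theorem map_le_ker_aeval_comp_iff (Q : Ideal (MvPolynomial σ K)) (y : σ → K) :
    Q.map (MvPolynomial.map (algebraMap K L)) ≤
        RingHom.ker (MvPolynomial.aeval (R := L) (algebraMap K L ∘ y)) ↔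
      Q ≤ RingHom.ker (MvPolynomial.aeval (R := K) y) := by
  have key : ∀ p : MvPolynomial σ K,
      MvPolynomial.aeval (algebraMap K L ∘ y) (MvPolynomial.map (algebraMap K L) p) =
        algebraMap K L (MvPolynomial.aeval y p) := fun p => by
    rw [aeval_map_algebraMap, aeval_algebraMap_apply]
  rw [Ideal.map_le_iff_le_comap]
  refine ⟨fun h p hp => ?_, fun h p hp => ?_⟩
  · have h1 := h hp
    rw [Ideal.mem_comap, RingHom.mem_ker, key] at h1
    rw [RingHom.mem_ker]
    exact (map_eq_zero_iff _ (algebraMap K L).injective).1 h1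
  · have h1 := h hp
    rw [RingHom.mem_ker] at h1
    rw [Ideal.mem_comap, RingHom.mem_ker, key, h1, map_zero]

/-- **The branches through a rational point correspond under extension of an algebraically closed
base field.** For `K` algebraically closed, `J ⊆ K[X_σ]`, `y ∈ K^σ` and an extension `L ⊇ K`, the
minimal primes over `J L[X_σ]` in `𝔪_y ⊆ L[X_σ]` are exactly the extensions `Q L[X_σ]` of the
minimal primes `Q` over `J` in `𝔪_y ⊆ K[X_σ]` (`minimalPrimes_map_of_isAlgClosed`, and vanishing at
the `K`-point `y` is tested over `K`). [cite: GortzWedhorn2020, Rem. 5.55] -/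
theorem branches_map_eq_image_of_isAlgClosed [IsAlgClosed K] (J : Ideal (MvPolynomial σ K))
    (y : σ → K) :
    {P : Ideal (MvPolynomial σ L) |
        P ∈ (J.map (MvPolynomial.map (algebraMap K L))).minimalPrimes ∧
          P ≤ RingHom.ker (MvPolynomial.aeval (R := L) (algebraMap K L ∘ y))} =
      Ideal.map (MvPolynomial.map (algebraMap K L)) ''
        {Q : Ideal (MvPolynomial σ K) |
          Q ∈ J.minimalPrimes ∧ Q ≤ RingHom.ker (MvPolynomial.aeval (R := K) y)} := by
  ext P
  constructor
  · rintro ⟨hP, hPy⟩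
    refine ⟨P.comap (MvPolynomial.map (algebraMap K L)),
      ⟨comap_mem_minimalPrimes_of_mem_minimalPrimes_map J hP, ?_⟩,
      map_comap_eq_of_mem_minimalPrimes_map J hP⟩
    rw [← map_le_ker_aeval_comp_iff (L := L), map_comap_eq_of_mem_minimalPrimes_map J hP]
    exact hPy
  · rintro ⟨Q, ⟨hQ, hQy⟩, rfl⟩
    exact ⟨map_mem_minimalPrimes_of_isAlgClosed J hQ, (map_le_ker_aeval_comp_iff Q y).2 hQy⟩

/-- Hence **the number of irreducible components through a rational point is the same over `K`
and over `L`** (`K` algebraically closed). [cite: GortzWedhorn2020, Rem. 5.55] -/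
theorem ncard_branches_map_of_isAlgClosed [IsAlgClosed K] (J : Ideal (MvPolynomial σ K))
    (y : σ → K) :
    {P : Ideal (MvPolynomial σ L) |
        P ∈ (J.map (MvPolynomial.map (algebraMap K L))).minimalPrimes ∧
          P ≤ RingHom.ker (MvPolynomial.aeval (R := L) (algebraMap K L ∘ y))}.ncard =
      {Q : Ideal (MvPolynomial σ K) |
        Q ∈ J.minimalPrimes ∧ Q ≤ RingHom.ker (MvPolynomial.aeval (R := K) y)}.ncard := by
  rw [branches_map_eq_image_of_isAlgClosed, Set.ncard_image_of_injective _ map_coeff_injective]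

end BaseChange

end Literature.RingTheory.MvPolynomial

end
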